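import Summits.BirchSwinnertonDyer.Rank1Residual.Additive.CensusX42ValRelation
import Summits.BirchSwinnertonDyer.Rank1Residual.Additive.CensusX42CoeffValuation
import HarnessLib

/-!
# Census relation X4-2 at WINDOW grade, IV: the `vReg_x42(v₁)` identity `ord_p q + ord_p Reg_p(E,Dh) = 1 + v₁`
# from the VALUATION relation (cell `b2b-bsdres`, census cell `bsd-formula-census`, seat
# `b2b-bsdres-census-ctyper1` = conjecture-typer 1, gen 6; the window-grade twin of gen 4's
# `CensusX42CoeffValuation.lean` p260391 — kernel of the informational KURREG column `vReg_x42(v₁)`,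
# n1011 PREDICTIONS-KURREG A1.6 / A5)

HONEST FRAMING (cell `b2b-bsdres`, run/shared/lean/b2b/bsd-rank1-residual/, verbatim in every
file): the goal of the cell is to DELETE the COMBINATION-SHAPED residual classes of the
Birch–Swinnerton-Dyer formula for ALL analytic-rank `≤ 1` elliptic curves over `ℚ` — "full BSD
formula for every rank `≤ 1` curve in class `C`" assembled STRICTLY from published theorems — so
that the rank-`≤ 1` remainder becomes exactly the CONSTRUCTION-SHAPED classes, which are TYPED
(missing-input `Prop`s), NOT attempted. This is not "finishing BSD". Census cell
(bsd-formula-census): research instrumentation; census output = EVIDENCE / conjecture items, never a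
Literature fact; labels / RESIDUAL-MAP marks UNCHANGED (O7-ord OPEN; X3♯ / X4♯ CONSTRUCTION-SHAPED);
nothing booked. THEOREMS ONLY (no definition, no named fact); modularity `hmodD` enters as a
HYPOTHESIS; the census relation `CensusX42.ValRelationAt W p Dh` (`CensusX42ValRelation.lean`,
`@[conjecture]`, X4-2 at WINDOW grade — EVIDENCE: X42-WINDOW.md sha256
`a10a170979128fde17cf31b1704581a6d978f587434da820ed86243fc49ef835`, X42-REPORT.md sha256
`e8592c9a2e1a59c13e754928288c9f6b1ce554f7ffb80b93db3c55aa7f5e9950`) and the coefficient-valuation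
records `CensusQ6.GordCoeffValAt W p 1 v₁` / `CensusQ6.MultCoeffValAt W p 1 v₁`
(`CensusQ6CoeffValuation.lean`) are HYPOTHESES at the pair.

## What

Gen 4 proved (`CensusX42CoeffValuation.lean`): on a semistable-twist rank-one row, the EXACT relation
`CensusX42.RelationAt W p Dh` and `‖[T¹](ϖ·B)‖_p = p^{−v₁}` give `Reg_p(E,Dh) ≠ 0` and
`ord_p q + ord_p Reg_p(E,Dh) = 1 + v₁` (`L'(E,1) = q·Ω_E·Reg_∞`), hence with `#Ш_an = s` the KURREG
column `ord_p Reg_p = 1 + v₁ + 2·ord_p #T − ord_p s − ord_p ∏c`. Only the VALUATION of the identity was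
used. This file re-derives the same conclusions from `CensusX42.ValRelationAt W p Dh` — the relation at
the grade the X4-2 WINDOW certified (429 pairs `N < 2·10⁴`, `v_p(A′) = v_p(h) + v_p(C)`, i.e. exactly
`1 + v₁ = v_p(h) + v_p(#Ш_an∏c/#T²)`; two engines each side): the norm clause
`‖ϖ·[T¹]L·log_p γ·#T²‖ = ‖s·Reg_p·∏c‖` is turned into `x·ℓ·#T² = u·(s·Reg_p·∏c)` with `‖u‖ = 1`
and fed to gen 4's cell-agnostic core `padicValRat_add_valuation_eq_of_identity_of_valuation`.

* §1 pointwise: `padicValRat_add_valuation_eq_of_valRelationAt_of_norm_coeff_one[_mult]`;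
* §2 record forms: `padicValRat_add_valuation_eq_of_valRelationAt_of_gordCoeffValAt_one` ((G-ord, `e = 2`)),
  `…_of_multCoeffValAt_one` ((M)); with `#Ш_an = s`:
  `valuation_padicRegulator_eq_of_valRelationAt_of_{gord,mult}CoeffValAt_one_of_shaAn`
  (`ord_p Reg_p(E,Dh) = 1 + v₁ + 2·ord_p #T − ord_p s − ord_p ∏c`, the WINDOW's own identity read for
  `ord_p h`: on the 429 window rows `v₁ + 1 = v_p(A′) ∈ {1,…,7}`, `s = 1`).

EVIDENCE-conditional on both census inputs; nothing about any curve asserted; nothing booked; KURREG's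
`vReg_x42` / `gap_x42` columns stay INFORMATIONAL (n1011-p17 A1.6).

References: B. Mazur, J. Tate, J. Teitelbaum, Invent. Math. 84 (1986) §I.10, §I.13
[MazurTateTeitelbaum1986Invent]; K. Iwasawa, Lectures on `p`-adic `L`-functions (1972) §4.4
[Iwasawa1972PadicL]; D. Delbourgo, Compositio Math. 113 (1998) §2.5 BS-D(p) (ii) [Delbourgo1998];
R. L. Miller, LMS J. Comput. Math. 14 (2011) Def. 1.1 [Miller2011LMS]; census files of record as above.
-/

set_option autoImplicit false

noncomputable section

open scoped Classical MatrixGroups ModularForm NumberField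

open CongruenceSubgroup WeierstrassCurve NumberField Literature.NumberTheory.EllipticCurves
  Literature.NumberTheory.EllipticCurves.ModularForms
  Literature.NumberTheory.EllipticCurves.Rank1Residual
  Literature.NumberTheory.EllipticCurves.Rank1Residual.Typed
  Literature.NumberTheory.GaloisRepresentations
  Literature.Barriers.BirchSwinnertonDyer
  IsDedekindDomain

namespace Summit.BirchSwinnertonDyer.Rank1Residual.Additive

namespace CensusX42

variable {p : ℕ} [hp : Fact p.Prime]

/-! ### §0 From a norm equality to an identity with a unit cofactor -/

/-- `‖x‖ = ‖y‖` with `x ≠ 0`: `x = u·y` for some `u` with `u ≠ 0`, `ord_p u = 0`. [folklore] -/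
private theorem exists_val_zero_mul_of_norm_eq {x y : ℚ_[p]} (hx : x ≠ 0) (h : ‖x‖ = ‖y‖) :
    ∃ u : ℚ_[p], u ≠ 0 ∧ u.valuation = 0 ∧ x = u * y := by
  have hy : y ≠ 0 := by
    rintro rfl
    exact hx (norm_eq_zero.mp (by rw [h, norm_zero]))
  have hn : ‖x / y‖ = 1 := by
    rw [norm_div, h, div_self (norm_ne_zero_iff.mpr hy)]
  obtain ⟨hu0, hu⟩ := valuation_eq_zero_of_norm_eq_one hn
  exact ⟨x / y, hu0, hu, by rw [div_mul_cancel₀ x hy]⟩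

/-- **Core (cell-agnostic), valuation form.** If `x ≠ 0` has `ord_p x = v`, `ord_p ℓ = 1`, `q ≠ 0`
and `‖x·ℓ·#T²‖ = ‖(q·#T²/∏c)·R·∏c‖` (the `ValRelationAt` clause with `s = q·#T²/∏c`), then `R ≠ 0` and
`ord_p q + ord_p R = 1 + v` (gen 4's exact-identity core after exhibiting the unit cofactor). [folklore] -/
theorem padicValRat_add_valuation_eq_of_norm_eq_of_valuation {W : WeierstrassCurve ℚ} [W.IsElliptic]
    {x ℓ R : ℚ_[p]} {q : ℚ} {v : ℤ} (hq : q ≠ 0) (hx0 : x ≠ 0) (hxv : x.valuation = v)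
    (hℓ0 : ℓ ≠ 0) (hℓ : ℓ.valuation = 1)
    (hn : ‖x * ℓ * (W.torsionOrder : ℚ_[p]) ^ 2‖ =
      ‖(((q * (W.torsionOrder : ℚ) ^ 2 / W.tamagawaProduct : ℚ) : ℚ_[p]) * R *
        (W.tamagawaProduct : ℚ_[p]))‖) :
    R ≠ 0 ∧ padicValRat p q + R.valuation = 1 + v := by
  have hT : (W.torsionOrder : ℚ_[p]) ^ 2 ≠ 0 :=
    pow_ne_zero 2 (by exact_mod_cast (W.torsionOrder_pos_holds).ne')
  obtain ⟨u, hu0, hu, hid⟩ :=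
    exists_val_zero_mul_of_norm_eq (mul_ne_zero (mul_ne_zero hx0 hℓ0) hT) hn
  refine padicValRat_add_valuation_eq_of_identity_of_valuation (W := W) hq hx0 hxv hℓ0 hℓ hu0 hu
    one_ne_zero Padic.valuation_one ?_
  rw [mul_one]
  exact hid

/-! ### §1 Pointwise: a twist model whose linear coefficient has valuation `v₁` -/

/-- **(G)-ordinary twist model, pointwise, from the VALUATION relation.** `W = E` globally minimal,
additive at the odd prime `p`, `r_an = 1`, `L'(E,1) = q·Ω_E·Reg_∞(E)` (`q ≠ 0`); `V` globally minimal
ORDINARY at `p` with `C • V^{(p*)} = W`, `f` a newform of `V`, `ϖ` the period ratio of the parity of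
`(p−1)/2`: if `‖[T¹](ϖ·B^{±})‖_p = p^{−v₁}` and `ValRelationAt W p Dh` holds, then `Reg_p(E,Dh) ≠ 0` and
`ord_p q + ord_p Reg_p(E,Dh) = 1 + v₁`. [cite: MazurTateTeitelbaum1986Invent, §I.13] [cite: Iwasawa1972PadicL, §4.4] -/
theorem padicValRat_add_valuation_eq_of_valRelationAt_of_norm_coeff_one (hp2 : p ≠ 2)
    {W : WeierstrassCurve ℚ} [W.IsElliptic] [W.IsGloballyMinimal] (hadd : Addv W p)
    (hr : W.analyticRank = 1) {q : ℚ} (hq : q ≠ 0)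
    (hLq : W.leadingLCoeff = (q : ℂ) * (W.realPeriodRat : ℂ) * (W.regulator : ℂ))
    (V : WeierstrassCurve ℚ) [V.IsElliptic] [V.IsGloballyMinimal] (C : VariableChange ℚ)
    (hC : C • V.quadraticTwist ((-1 : ℚ) ^ (p / 2) * p) = W) (hord : IsOrdinaryAt V p)
    {N : ℕ} [NeZero N] {f : CuspForm (Gamma0 N) 2} (hf : IsNewformOf V f)
    (ϖ : ℚ) (hϖ : if Even (p / 2) then (ϖ : ℝ) * V.realPeriodRat = plusPeriod f
      else (ϖ : ℝ) * V.imaginaryPeriodRat = minusPeriod f)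
    {v₁ : ℤ} (hv₁ : ‖PowerSeries.coeff 1 (PowerSeries.C (ϖ : ℚ_[p]) *
        (if Even (p / 2) then padicLFunctionBranch f ((unitRoot V p : ℤ_[p]) : ℚ_[p]) (p / 2)
          else padicLFunctionMinusBranch f ((unitRoot V p : ℤ_[p]) : ℚ_[p]) (p / 2)))‖ =
        (p : ℝ) ^ (-v₁))
    {Dh : PAdicHeightData W p} (hrel : ValRelationAt W p Dh) :
    padicRegulator Dh ≠ 0 ∧ padicValRat p q + (padicRegulator Dh).valuation = 1 + v₁ := by
  have hs := shaAn_eq_of_leadingLCoeff_eq W hLq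
  obtain ⟨heven, hodd⟩ := hrel V C f hadd (Or.inl hord.1) hf hr _ hs
  obtain ⟨hℓ0, hℓ⟩ := X2.valuation_padicLog_cyclotomicGenerator (p := p) hp2
  have hodd4 : p % 4 = 1 ∨ p % 4 = 3 := by
    obtain ⟨k, hk⟩ := hp.out.odd_of_ne_two hp2
    omega
  rcases hodd4 with h1 | h3
  · have hev : Even (p / 2) := ⟨p / 4, by omega⟩
    have hC' : C • V.quadraticTwist (p : ℚ) = W := by
      rw [pStar_eq_of_mod_four p (Or.inl h1), if_pos h1] at hC; exact hC
    rw [if_pos hev] at hϖ hv₁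
    rw [PowerSeries.coeff_C_mul] at hv₁
    obtain ⟨hx0, hxv⟩ := CensusQ6.norm_eq_zpow_neg_iff.mp hv₁
    obtain ⟨-, -, hn⟩ := (heven h1 hC' ϖ hϖ).1 hord
    exact padicValRat_add_valuation_eq_of_norm_eq_of_valuation (W := W) hq hx0 hxv hℓ0 hℓ hn
  · have hnev : ¬ Even (p / 2) := by rw [Nat.not_even_iff_odd]; exact ⟨p / 4, by omega⟩
    have hC' : C • V.quadraticTwist (-(p : ℚ)) = W := by
      rw [pStar_eq_of_mod_four p (Or.inr h3), if_neg (by omega)] at hC; exact hC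
    rw [if_neg hnev] at hϖ hv₁
    rw [PowerSeries.coeff_C_mul] at hv₁
    obtain ⟨hx0, hxv⟩ := CensusQ6.norm_eq_zpow_neg_iff.mp hv₁
    obtain ⟨-, -, hn⟩ := (hodd h3 hC' ϖ hϖ).1 hord
    exact padicValRat_add_valuation_eq_of_norm_eq_of_valuation (W := W) hq hx0 hxv hℓ0 hℓ hn

/-- **Multiplicative twist model, pointwise, from the VALUATION relation** (`V` MULTIPLICATIVE at `p`,
`ã = a_p(V) = ±1`, one-term branches). [cite: MazurTateTeitelbaum1986Invent, §I.10, §I.13]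
[cite: Iwasawa1972PadicL, §4.4] -/
theorem padicValRat_add_valuation_eq_of_valRelationAt_of_norm_coeff_one_mult (hp2 : p ≠ 2)
    {W : WeierstrassCurve ℚ} [W.IsElliptic] [W.IsGloballyMinimal] (hadd : Addv W p)
    (hr : W.analyticRank = 1) {q : ℚ} (hq : q ≠ 0)
    (hLq : W.leadingLCoeff = (q : ℂ) * (W.realPeriodRat : ℂ) * (W.regulator : ℂ))
    (V : WeierstrassCurve ℚ) [V.IsElliptic] [V.IsGloballyMinimal] (C : VariableChange ℚ)
    (hC : C • V.quadraticTwist ((-1 : ℚ) ^ (p / 2) * p) = W) (hV : Mult V p)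
    {N : ℕ} [NeZero N] {f : CuspForm (Gamma0 N) 2} (hf : IsNewformOf V f)
    (ϖ : ℚ) (hϖ : if Even (p / 2) then (ϖ : ℝ) * V.realPeriodRat = plusPeriod f
      else (ϖ : ℝ) * V.imaginaryPeriodRat = minusPeriod f)
    {v₁ : ℤ} (hv₁ : ‖PowerSeries.coeff 1 (PowerSeries.C (ϖ : ℚ_[p]) *
        (if Even (p / 2) then padicLFunctionPlusBranchMult f (((V.LFunction p : ℤ)) : ℚ_[p]) (p / 2)
          else padicLFunctionMinusBranchMult f (((V.LFunction p : ℤ)) : ℚ_[p]) (p / 2)))‖ =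
        (p : ℝ) ^ (-v₁))
    {Dh : PAdicHeightData W p} (hrel : ValRelationAt W p Dh) :
    padicRegulator Dh ≠ 0 ∧ padicValRat p q + (padicRegulator Dh).valuation = 1 + v₁ := by
  have hs := shaAn_eq_of_leadingLCoeff_eq W hLq
  obtain ⟨heven, hodd⟩ := hrel V C f hadd (Or.inr hV) hf hr _ hs
  obtain ⟨hℓ0, hℓ⟩ := X2.valuation_padicLog_cyclotomicGenerator (p := p) hp2
  have hodd4 : p % 4 = 1 ∨ p % 4 = 3 := by
    obtain ⟨k, hk⟩ := hp.out.odd_of_ne_two hp2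
    omega
  rcases hodd4 with h1 | h3
  · have hev : Even (p / 2) := ⟨p / 4, by omega⟩
    have hC' : C • V.quadraticTwist (p : ℚ) = W := by
      rw [pStar_eq_of_mod_four p (Or.inl h1), if_pos h1] at hC; exact hC
    rw [if_pos hev] at hϖ hv₁
    rw [PowerSeries.coeff_C_mul] at hv₁
    obtain ⟨hx0, hxv⟩ := CensusQ6.norm_eq_zpow_neg_iff.mp hv₁
    obtain ⟨-, -, hn⟩ := (heven h1 hC' ϖ hϖ).2 hV
    exact padicValRat_add_valuation_eq_of_norm_eq_of_valuation (W := W) hq hx0 hxv hℓ0 hℓ hn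
  · have hnev : ¬ Even (p / 2) := by rw [Nat.not_even_iff_odd]; exact ⟨p / 4, by omega⟩
    have hC' : C • V.quadraticTwist (-(p : ℚ)) = W := by
      rw [pStar_eq_of_mod_four p (Or.inr h3), if_neg (by omega)] at hC; exact hC
    rw [if_neg hnev] at hϖ hv₁
    rw [PowerSeries.coeff_C_mul] at hv₁
    obtain ⟨hx0, hxv⟩ := CensusQ6.norm_eq_zpow_neg_iff.mp hv₁
    obtain ⟨-, -, hn⟩ := (hodd h3 hC' ϖ hϖ).2 hV
    exact padicValRat_add_valuation_eq_of_norm_eq_of_valuation (W := W) hq hx0 hxv hℓ0 hℓ hn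

/-! ### §2 From the census record `v₁` on the semistable-twist rows -/

/-- **(G-ord, `e = 2`) rows, `r_an = 1`: the record `CensusQ6.GordCoeffValAt W p 1 v₁` + the VALUATION
relation at the pair ⟹ `Reg_p(E,Dh) ≠ 0 ∧ ord_p q + ord_p Reg_p(E,Dh) = 1 + v₁`** (twist model, newform and
period ratio are kernel theorems; no class / image / CM / anomalous binder). EVIDENCE-conditional on both
census inputs. [cite: MazurTateTeitelbaum1986Invent, §I.13] [cite: Iwasawa1972PadicL, §4.4] -/
theorem padicValRat_add_valuation_eq_of_valRelationAt_of_gordCoeffValAt_one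
    (hmodD : nonempty_modularParametrizationData) (hp2 : p ≠ 2)
    {W : WeierstrassCurve ℚ} [W.IsElliptic] [W.IsGloballyMinimal] (hG : TypeGOrd W p)
    (hadd : Addv W p) (he : semistabilityIndex W p = 2) (hr : W.analyticRank = 1) {q : ℚ} (hq : q ≠ 0)
    (hLq : W.leadingLCoeff = (q : ℂ) * (W.realPeriodRat : ℂ) * (W.regulator : ℂ))
    {v₁ : ℤ} (hval : CensusQ6.GordCoeffValAt W p 1 v₁)
    {Dh : PAdicHeightData W p} (hrel : ValRelationAt W p Dh) :
    padicRegulator Dh ≠ 0 ∧ padicValRat p q + (padicRegulator Dh).valuation = 1 + v₁ := by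
  obtain ⟨V, iV, iVm, C, hV, hC⟩ := TypeGOrd.exists_goodOrd_pStar_twist_model W p hp2 hG hadd he
  haveI : NeZero (V.conductorNorm ℤ) := ⟨(V.conductorNorm_pos_holds).ne'⟩
  obtain ⟨Dm⟩ := hmodD V
  obtain ⟨ϖ, hϖ⟩ := exists_periodRatio_parity (p := p) V Dm
  have hord : IsOrdinaryAt V p := hV
  exact padicValRat_add_valuation_eq_of_valRelationAt_of_norm_coeff_one hp2 hadd hr hq hLq V C hC hord
    Dm.isNewformOf ϖ hϖ (hval V C hC hord Dm.f Dm.isNewformOf ϖ hϖ) hrel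

/-- **(M) rows, `r_an = 1`: the record `CensusQ6.MultCoeffValAt W p 1 v₁` + the VALUATION relation at the
pair ⟹ `Reg_p(E,Dh) ≠ 0 ∧ ord_p q + ord_p Reg_p(E,Dh) = 1 + v₁`** (`AdditivePotMult.PotMult W p`).
EVIDENCE-conditional. [cite: MazurTateTeitelbaum1986Invent, §I.10, §I.13] [cite: SilvermanATAEC1994, V.5.3] -/
theorem padicValRat_add_valuation_eq_of_valRelationAt_of_multCoeffValAt_one
    (hmodD : nonempty_modularParametrizationData) (hp2 : p ≠ 2)
    {W : WeierstrassCurve ℚ} [W.IsElliptic] [W.IsGloballyMinimal] (hpm : AdditivePotMult.PotMult W p)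
    (hr : W.analyticRank = 1) {q : ℚ} (hq : q ≠ 0)
    (hLq : W.leadingLCoeff = (q : ℂ) * (W.realPeriodRat : ℂ) * (W.regulator : ℂ))
    {v₁ : ℤ} (hval : CensusQ6.MultCoeffValAt W p 1 v₁)
    {Dh : PAdicHeightData W p} (hrel : ValRelationAt W p Dh) :
    padicRegulator Dh ≠ 0 ∧ padicValRat p q + (padicRegulator Dh).valuation = 1 + v₁ := by
  obtain ⟨V, iV, iVm, C, hV, hC⟩ := hpm.exists_mult_pStar_twist_model hp2
  haveI : NeZero (V.conductorNorm ℤ) := ⟨(V.conductorNorm_pos_holds).ne'⟩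
  obtain ⟨Dm⟩ := hmodD V
  obtain ⟨ϖ, hϖ⟩ := exists_periodRatio_parity (p := p) V Dm
  exact padicValRat_add_valuation_eq_of_valRelationAt_of_norm_coeff_one_mult hp2 hpm.1 hr hq hLq V C hC
    hV Dm.isNewformOf ϖ hϖ
    (hval V C hV hC Dm.f Dm.isNewformOf (V.LFunction p) (Dm.isNewformOf.2 p) ϖ hϖ) hrel

/-- **`vReg_x42(v₁)` on the (G-ord, `e = 2`) rows at WINDOW grade.** With `#Ш_an = s` (`s ≠ 0`), the
record `CensusQ6.GordCoeffValAt W p 1 v₁` and the VALUATION relation at the pair: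
`ord_p Reg_p(E,Dh) = 1 + v₁ + 2·ord_p #T − ord_p s − ord_p ∏c` — the WINDOW's identity
`v_p(A′) = v_p(h) + v_p(s∏c/#T²)` (`v_p(A′) = 1 + v₁`) solved for `v_p(h)`, with `h` READ as `Reg_p(E,Dh)`.
[cite: MazurTateTeitelbaum1986Invent, §I.13] [cite: Miller2011LMS, Def. 1.1] -/
theorem valuation_padicRegulator_eq_of_valRelationAt_of_gordCoeffValAt_one_of_shaAn
    (hmodD : nonempty_modularParametrizationData) (hp2 : p ≠ 2)
    {W : WeierstrassCurve ℚ} [W.IsElliptic] [W.IsGloballyMinimal] (hG : TypeGOrd W p)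
    (hadd : Addv W p) (he : semistabilityIndex W p = 2) (hr : W.analyticRank = 1)
    {s : ℚ} (hs : shaAn W = (s : ℂ)) (hs0 : s ≠ 0)
    {v₁ : ℤ} (hval : CensusQ6.GordCoeffValAt W p 1 v₁)
    {Dh : PAdicHeightData W p} (hrel : ValRelationAt W p Dh) :
    padicRegulator Dh ≠ 0 ∧ (padicRegulator Dh).valuation =
      1 + v₁ + 2 * padicValNat p W.torsionOrder - padicValRat p s - padicValNat p W.tamagawaProduct := by
  obtain ⟨hq0, hqv⟩ := padicValRat_shaAn_ratio (p := p) W hs0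
  obtain ⟨hR, hid⟩ := padicValRat_add_valuation_eq_of_valRelationAt_of_gordCoeffValAt_one hmodD hp2 hG
    hadd he hr hq0 (leadingLCoeff_eq_of_shaAn_eq W hs) hval hrel
  refine ⟨hR, ?_⟩
  rw [hqv] at hid
  linarith

/-- **`vReg_x42(v₁)` on the (M) rows at WINDOW grade** (`E` potentially multiplicative at `p`).
[cite: MazurTateTeitelbaum1986Invent, §I.10, §I.13] [cite: Miller2011LMS, Def. 1.1] -/
theorem valuation_padicRegulator_eq_of_valRelationAt_of_multCoeffValAt_one_of_shaAn
    (hmodD : nonempty_modularParametrizationData) (hp2 : p ≠ 2)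
    {W : WeierstrassCurve ℚ} [W.IsElliptic] [W.IsGloballyMinimal] (hpm : AdditivePotMult.PotMult W p)
    (hr : W.analyticRank = 1) {s : ℚ} (hs : shaAn W = (s : ℂ)) (hs0 : s ≠ 0)
    {v₁ : ℤ} (hval : CensusQ6.MultCoeffValAt W p 1 v₁)
    {Dh : PAdicHeightData W p} (hrel : ValRelationAt W p Dh) :
    padicRegulator Dh ≠ 0 ∧ (padicRegulator Dh).valuation =
      1 + v₁ + 2 * padicValNat p W.torsionOrder - padicValRat p s - padicValNat p W.tamagawaProduct := by
  obtain ⟨hq0, hqv⟩ := padicValRat_shaAn_ratio (p := p) W hs0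
  obtain ⟨hR, hid⟩ := padicValRat_add_valuation_eq_of_valRelationAt_of_multCoeffValAt_one hmodD hp2 hpm
    hr hq0 (leadingLCoeff_eq_of_shaAn_eq W hs) hval hrel
  refine ⟨hR, ?_⟩
  rw [hqv] at hid
  linarith

end CensusX42

end Summit.BirchSwinnertonDyer.Rank1Residual.Additive

end
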